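import Mathlib

/-!
# Quarter-turn L design in `ZMod 61` (`s = 4`, `n = 4`) — calibration witness for `PrimeDensityDecay`

Item stmt-MatrixMultiplication-14311 (`FourierTwoFamiliesModP.PrimeDensityDecay`), calibration of the small-modulus census
recorded in `Theorems/PrimeDensityDecay/Negative/PrimeWlog.lean` (`s_four_witness_30` docstring: "consistent with
`n_max(p) = ⌊p/s²⌋` for PRIME `p` at `s ≤ 4` (open)").  That guess is FALSE: in the prime field `ZMod 61` there is a
balanced SDPP family with `s = 4` and `n = 4 > ⌊61/16⌋ = 3` (`4·4² = 64 > 61`), kernel-checked below by `decide`.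

Member `s = 4` of the explicit family (prover-pitem stmt-MatrixMultiplication-14311, 2026-08-16):
`N = (s+1)² + (s+2)²`, `g = 2s+3` (`g² ≡ −1`), `h = (s+1)(s+2)`, blocks `A_u = g^u · g·(h − [1,s])`,
`B_u = −g^u · [1,s]`, `u < 4` — four quarter-turn rotations of one L-shaped block on the torus
`ℤ[i]/((s+1)+(s+2)i)`.  Balanced SDPP with `n·s² = 64 > N = 61` (prime).
-/

-- the doubled path component `MatrixMultiplication.MatrixMultiplication` is the tree's layout (summit = problem)
set_option linter.dupNamespace false

namespace Summit.MatrixMultiplication.MatrixMultiplication.Theorems.PrimeDensityDecay.QuarterTurn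

-- `decide` evaluates clause (X) on 4³·4⁴ = 16384 instances of a `ZMod 61` identity (kernel ≈ 100 s): deeper recursion and
-- more heartbeats than the defaults are needed for this single computation.
set_option maxRecDepth 400000 in
set_option maxHeartbeats 40000000 in
/-- Registered stub `stub_quarterTurnWitness61`: a balanced SDPP family in the prime field `ZMod 61` with `s = 4` and
`n = 4` blocks (`A = ![{3,14,42,53}, {32,…,35}, {8,19,47,58}, {26,…,29}]`, `B = ![{57,…,60}, {17,28,39,50}, {1,…,4},
{11,22,33,44}]` — member `s = 4` of the quarter-turn family), hence `n·s² = 64 > 61` and `n_max(61,4) ≥ 4 > ⌊61/16⌋`: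
the guess "`n_max(p,4) = ⌊p/16⌋` for prime `p`" recorded as open in `Negative/PrimeWlog.lean` is false. -/
theorem stub_quarterTurnWitness61 : ∃ (A B : Fin 4 → Finset (ZMod 61)),
    (∀ i : Fin 4, (A i).card = 4 ∧ (B i).card = 4) ∧
    (∀ i : Fin 4, ∀ a ∈ A i, ∀ a' ∈ A i, ∀ b ∈ B i, ∀ b' ∈ B i, (a - a') + (b - b') = 0 → a = a' ∧ b = b') ∧
    (∀ i j k : Fin 4, ∀ a ∈ A i, ∀ a' ∈ A j, ∀ b ∈ B j, ∀ b' ∈ B k, (a - a') + (b - b') = 0 → i = k) ∧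
    (61 : ℕ) < 4 * 4 ^ 2 :=
  ⟨![{3, 14, 42, 53}, {32, 33, 34, 35}, {8, 19, 47, 58}, {26, 27, 28, 29}],
   ![{57, 58, 59, 60}, {17, 28, 39, 50}, {1, 2, 3, 4}, {11, 22, 33, 44}],
   by decide, by decide, by decide, by norm_num⟩

end Summit.MatrixMultiplication.MatrixMultiplication.Theorems.PrimeDensityDecay.QuarterTurn
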